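import Literature.AlgebraicGeometry.Hu2025.Proofs.S03Pluecker.GammaQuadTorus
import HarnessLib

/-!
# Hu 2025 / [Hu22] p.131 — the torus normalisation `ν` of the quad cell is TORUS-INVARIANT: `scale s ∘ ν = ν` and
# `scale s ∘ πJ = πJ` for every torus element `s ∈ (kˣ)⁹` (joint J1 / GAP-LEDGER-HU row HU-R01, reading (β) — kernel support, OURS)

**HONEST FRAMING (D-0012/D-0089).** [Hu2025] (arXiv:2507.21400v1) and [Hu2022] (arXiv:2203.03842v4) are unrefereed preprints under
adjudication; nothing of them is asserted. OURS objects only (sequel of `GammaQuadTorus.lean`, typed carriers of rows 101/110).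

[Hu22] p.131 l.6–16: «We identify `U ⊂ X × 𝔸^r` with the quotient space `Gr̄^{3,E}_d = Gr^{3,E}_d/(𝔾ⁿ_m/𝔾_m)`. Consider the quotient map
`π : Gr^{3,E}_d → Gr̄^{3,E}_d`». In `GammaQuadTorus.lean` the quotient map for `d = quad` is realised at ring level as
`πJ : Rh ⧸ J → Rh` (induced by the torus normalisation `ν = scale τ`, `A ↦ τ(A)·A`). THIS FILE proves that it IS constant on torus
orbits: for every `k`-rational torus element `s = (s₁,…,s₉) ∈ (kˣ)⁹`, acting on the cell ring by `scale (constWeights s)`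
(`x̄_u ↦ (s_{u₁}s_{u₂}s_{u₃}/s₁s₂s₃)·x̄_u`), one has `scale (constWeights s) ∘ ν = ν` (`scale_const_comp_ν`) and hence
`scale (constWeights s) ∘ πJ = πJ` (`scale_const_comp_πJ`): the normal form of `s·A` is the normal form of `A`. Mechanism: under `s`
the normalising weights transform by `τ_a ↦ (s₄/s_a)·τ_a` (`unitsMap_scale_τ`), so every weight `c_t(τ)` is multiplied by exactly
`c_t(s)⁻¹` (`unitsMap_scale_cwU`). Together with the section (`mk_comp_πJ`) this exhibits `Spec (Rh ⧸ J)` as the orbit space of the free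
torus action on the cell at the level the record can state. AI proof is weaker than expert review.
-/

noncomputable section

namespace Literature.AlgebraicGeometry.Hu2025.Statements.S03Pluecker

open MvPolynomial Matrix

namespace QuadTorus

open QuadCell

variable (k : Type) [Field k]

/-! ## Weights as units; multiplicativity -/

/-- The weight `c_t(σ)` as a UNIT: `σ₁⁻¹ σ₂⁻¹ σ₃⁻¹ σ_{t₁} σ_{t₂} σ_{t₃}`. OURS plumbing.
[cite: Hu2025, Thm. 9.3/9.4 («the action of 𝔾ⁿ_m/𝔾_m on Gr^{d,n}_d») p.160–161; [Hu22] p.131 l.6–16; joint J1 = GAP-LEDGER-HU row HU-R01 (unrefereed preprints under adjudication, D-0012/D-0089 — kernel support on OUR typed carriers of rows 101/110; nothing of the sources asserted)] -/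
def cwU (σ : ℕ → (Rh k)ˣ) (t : ℕ × ℕ × ℕ) : (Rh k)ˣ :=
  (σ 1)⁻¹ * (σ 2)⁻¹ * (σ 3)⁻¹ * σ t.1 * σ t.2.1 * σ t.2.2

/-- `↑(cwU σ t) = cw σ t`.
[cite: Hu2025, Thm. 9.3/9.4 p.160–161; joint J1 = GAP-LEDGER-HU row HU-R01 (unrefereed preprints under adjudication, D-0012/D-0089 — kernel support on OUR typed carriers of rows 101/110; nothing of the sources asserted)] -/
theorem coe_cwU (σ : ℕ → (Rh k)ˣ) (t : ℕ × ℕ × ℕ) : (cwU k σ t : Rh k) = cw k σ t := by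
  simp only [cwU, cw, rw, Units.val_mul]

/-- A ring endomorphism maps weights to the weights of the mapped family: `f (c_t(σ)) = c_t(f ∘ σ)`.
[cite: Hu2025, Thm. 9.3/9.4 p.160–161; joint J1 = GAP-LEDGER-HU row HU-R01 (unrefereed preprints under adjudication, D-0012/D-0089 — kernel support on OUR typed carriers of rows 101/110; nothing of the sources asserted)] -/
theorem unitsMap_cwU (f : Rh k →+* Rh k) (σ : ℕ → (Rh k)ˣ) (t : ℕ × ℕ × ℕ) :
    Units.map (f : Rh k →* Rh k) (cwU k σ t) = cwU k (fun a => Units.map (f : Rh k →* Rh k) (σ a)) t := by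
  simp only [cwU, map_mul, map_inv]

/-! ## Constant torus elements `s ∈ (kˣ)⁹` -/

/-- The `k`-rational torus element `s = (s_a)` as column weights in `Rh`. OURS.
[cite: Hu2025, Thm. 9.3/9.4 («the action of 𝔾ⁿ_m/𝔾_m on Gr^{d,n}_d … acts freely on the matroid Schubert cell») p.160–161; [Hu22] p.131 l.6–16; joint J1 = GAP-LEDGER-HU row HU-R01 (unrefereed preprints under adjudication, D-0012/D-0089 — kernel support on OUR typed carriers of rows 101/110; nothing of the sources asserted)] -/
def constWeights (s : ℕ → kˣ) : ℕ → (Rh k)ˣ := fun a => Units.map (algebraMap k (Rh k) : k →* Rh k) (s a)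

variable (s : ℕ → kˣ)

/-- `scale s` fixes the constant weights (they are scalars).
[cite: Hu2025, Thm. 9.3/9.4 p.160–161; joint J1 = GAP-LEDGER-HU row HU-R01 (unrefereed preprints under adjudication, D-0012/D-0089 — kernel support on OUR typed carriers of rows 101/110; nothing of the sources asserted)] -/
theorem scale_constWeights (σ : ℕ → (Rh k)ˣ) (a : ℕ) :
    scale k σ (constWeights k s a : Rh k) = constWeights k s a := by
  show scale k σ (algebraMap k (Rh k) (s a : k)) = algebraMap k (Rh k) (s a : k)
  rw [← toRh_C, scale_toRh_C]

/-- … as units.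
[cite: Hu2025, Thm. 9.3/9.4 p.160–161; joint J1 = GAP-LEDGER-HU row HU-R01 (unrefereed preprints under adjudication, D-0012/D-0089 — kernel support on OUR typed carriers of rows 101/110; nothing of the sources asserted)] -/
theorem unitsMap_scale_constWeights (σ : ℕ → (Rh k)ˣ) (a : ℕ) :
    Units.map (scale k σ : Rh k →* Rh k) (constWeights k s a) = constWeights k s a :=
  Units.ext (scale_constWeights k s σ a)

/-- **The torus moves the matrix-entry units**: `s · A_{a,i} = (s_a / s_{i+1}) A_{a,i}` as units (`3 < a ≤ 9`).
[cite: Hu2025, Thm. 9.3/9.4 («the action of 𝔾ⁿ_m/𝔾_m on Gr^{d,n}_d») p.160–161; [Hu22] p.131 l.6–16; joint J1 = GAP-LEDGER-HU row HU-R01 (unrefereed preprints under adjudication, D-0012/D-0089 — kernel support on OUR typed carriers of rows 101/110; nothing of the sources asserted)] -/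
theorem unitsMap_scale_uA {a : ℕ} (ha : 3 < a) (ha9 : a ≤ 9) (i : Fin 3) :
    Units.map (scale k (constWeights k s) : Rh k →* Rh k) (uA k a i) =
      (constWeights k s (i.val + 1))⁻¹ * constWeights k s a * uA k a i := by
  apply Units.ext
  rw [Units.coe_map, MonoidHom.coe_coe, coe_uA k ha ha9, scale_A k _ (by omega) ha9, Units.val_mul, Units.val_mul,
    coe_uA k ha ha9]
  fin_cases i <;> rfl

/-- **The torus moves the normalising weights by `τ_a ↦ (s₄/s_a)·τ_a`** (`1 ≤ a ≤ 9`).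
[cite: Hu2025, Thm. 9.4 («(𝔾ⁿ_m/𝔾_m) acts freely on the matroid Schubert cell») p.161; [Hu22] p.131 l.6–16; joint J1 = GAP-LEDGER-HU row HU-R01 (unrefereed preprints under adjudication, D-0012/D-0089 — kernel support on OUR typed carriers of rows 101/110; nothing of the sources asserted)] -/
theorem unitsMap_scale_τ {a : ℕ} (ha1 : 1 ≤ a) (ha9 : a ≤ 9) :
    Units.map (scale k (constWeights k s) : Rh k →* Rh k) (τ k a) =
      constWeights k s 4 * (constWeights k s a)⁻¹ * τ k a := by
  have h4 := unitsMap_scale_uA k s (a := 4) (by norm_num) (by norm_num)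
  by_cases ha : 4 ≤ a
  · have e : τ k a = uA k 4 0 * (uA k a 0)⁻¹ := by
      unfold τ; rw [if_neg (by omega), if_neg (by omega), if_neg (by omega), if_pos ⟨ha, ha9⟩]
    rw [e, map_mul, map_inv, h4 0, unitsMap_scale_uA k s (by omega) ha9 0]
    apply Additive.ofMul.injective
    simp only [ofMul_mul, ofMul_inv, Fin.val_zero]
    abel
  · have ha' : a = 1 ∨ a = 2 ∨ a = 3 := by omega
    rcases ha' with rfl | rfl | rfl
    · have e : τ k 1 = uA k 4 0 := by simp [τ]
      rw [e, h4 0]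
      apply Additive.ofMul.injective
      simp only [ofMul_mul, ofMul_inv, Fin.val_zero]
      abel
    · have e : τ k 2 = uA k 4 1 := by simp [τ]
      rw [e, h4 1]
      apply Additive.ofMul.injective
      simp only [ofMul_mul, ofMul_inv, Fin.val_one]
      abel
    · have e : τ k 3 = uA k 4 2 := by simp [τ]
      rw [e, h4 2]
      apply Additive.ofMul.injective
      simp only [ofMul_mul, ofMul_inv, Fin.val_two]
      abel

/-- **Each normalisation weight `c_t(τ)` is multiplied by exactly `c_t(s)⁻¹` under the torus element `s`** (`t` a chart index).
[cite: Hu2025, Thm. 9.4 p.161; [Hu22] p.131 l.6–16; joint J1 = GAP-LEDGER-HU row HU-R01 (unrefereed preprints under adjudication, D-0012/D-0089 — kernel support on OUR typed carriers of rows 101/110; nothing of the sources asserted)] -/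
theorem unitsMap_scale_cwU {t : ℕ × ℕ × ℕ} (ht : t ∈ plVarSet 9) :
    Units.map (scale k (constWeights k s) : Rh k →* Rh k) (cwU k (τ k) t) * cwU k (constWeights k s) t = cwU k (τ k) t := by
  have hidx := mem_plIndexSet_iff.mp (Finset.mem_erase.mp ht).2
  rw [unitsMap_cwU]
  simp only [cwU]
  rw [unitsMap_scale_τ k s (a := 1) le_rfl (by norm_num), unitsMap_scale_τ k s (a := 2) (by norm_num) (by norm_num),
    unitsMap_scale_τ k s (a := 3) (by norm_num) (by norm_num), unitsMap_scale_τ k s (a := t.1) (by omega) (by omega),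
    unitsMap_scale_τ k s (a := t.2.1) (by omega) (by omega), unitsMap_scale_τ k s (a := t.2.2) (by omega) (by omega)]
  apply Additive.ofMul.injective
  simp only [ofMul_mul, ofMul_inv, _root_.mul_inv_rev]
  abel

/-- **T-INVARIANCE of the normalisation: `scale s ∘ ν = ν`** for every torus element `s ∈ (kˣ)⁹` — the normal form of `s·A` equals
the normal form of `A`.
[cite: Hu2025, Thm. 9.4 («(𝔾ⁿ_m/𝔾_m) acts freely on the matroid Schubert cell … the quotient space Gr̄_d := Gr_d/(𝔾ⁿ_m/𝔾_m)») p.161; [Hu22] p.131 l.6–16 («Consider the quotient map π : Gr_d → Gr̄_d»); joint J1 = GAP-LEDGER-HU row HU-R01 (unrefereed preprints under adjudication, D-0012/D-0089 — kernel support on OUR typed carriers of rows 101/110; nothing of the sources asserted)] -/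
theorem scale_const_comp_ν : (scale k (constWeights k s)).comp (ν k) = ν k := by
  apply IsLocalization.ringHom_ext (Submonoid.powers (hq k))
  apply Ideal.Quotient.ringHom_ext
  refine MvPolynomial.ringHom_ext (fun c => ?_) (fun x => ?_)
  · simp only [RingHom.comp_apply]
    have h1 := scale_toRh_C k (τ k) c
    have h2 := scale_toRh_C k (constWeights k s) c
    rw [toRh, RingHom.comp_apply] at h1 h2
    rw [ν, h1, h2]
  · simp only [RingHom.comp_apply]
    obtain ⟨t, ht⟩ := x
    have e : (X ⟨t, ht⟩ : ChartRing 9 k) = xbar k t := (xbar_of_mem k ht).symm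
    have hm : (algebraMap (Rq k) (Rh k)) (Ideal.Quotient.mk (gammaChartIdeal k 9 quadGamma) (X ⟨t, ht⟩)) = m k t := by
      rw [e]; rfl
    rw [hm, ν, scale_m k (τ k) ht, map_mul, scale_m k (constWeights k s) ht, ← coe_cwU, ← coe_cwU, ← mul_assoc]
    have hu := congrArg Units.val (unitsMap_scale_cwU k s ht)
    rw [Units.val_mul, Units.coe_map, MonoidHom.coe_coe] at hu
    rw [hu]

/-- **T-INVARIANCE of the quotient map: `scale s ∘ πJ = πJ`** — the ring-level statement that `Spec πJ : Gr_d → Spec (Rh ⧸ J)` is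
constant on the orbits of the torus `(kˣ)⁹` (with the section `mk_comp_πJ`, `Spec (Rh ⧸ J)` is the orbit space `Gr_d/(𝔾⁹_m/𝔾_m)` at the
level OUR records can state).
[cite: Hu2025, Thm. 9.4 («U is isomorphic to the quotient space Gr̄_d := Gr_d/(𝔾ⁿ_m/𝔾_m)») p.161; [Hu22] p.131 l.6–16 («We identify U … with the quotient space … Consider the quotient map π»); joint J1 = GAP-LEDGER-HU row HU-R01 (unrefereed preprints under adjudication, D-0012/D-0089 — kernel support on OUR typed carriers of rows 101/110; nothing of the sources asserted)] -/
theorem scale_const_comp_πJ : (scale k (constWeights k s)).comp (πJ k) = πJ k := by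
  apply Ideal.Quotient.ringHom_ext
  rw [RingHom.comp_assoc, πJ, Ideal.Quotient.lift_comp_mk, scale_const_comp_ν]

end QuadTorus

end Literature.AlgebraicGeometry.Hu2025.Statements.S03Pluecker

end
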